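import Summits.CriticalPhenomena.CardyFormulaZ2.Theses.CardyUSTContinuation
import Summits.CriticalPhenomena.CardyFormulaZ2.Theorems.CardyUSTContinuationUniformAnalyticExtensionStubRatioToCrux
import Summits.CriticalPhenomena.CardyFormulaZ2.Theorems.CardyUSTContinuationUniformAnalyticExtensionStubZeroFreeCrossing
import Summits.CriticalPhenomena.CardyFormulaZ2.Theorems.CardyUSTContinuationTargetUniform
import Summits.CriticalPhenomena.CardyFormulaZ2.Theorems.CardyUSTContinuationContinuumFamily
import Literature.Probability.LatticeModels.FKTwoArcPartitionPolynomials
import HarnessLib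

/-!
# Stub `stub_zeroFreeCrossing` of the line `registered` (skeleton v6, Schottky cut) for the crux
# `UniformAnalyticExtension` (stmt-CriticalPhenomena-6047, route `CardyUSTContinuation`):
# the crossing ratio OMITS `0` AND `1` under the route thesis `Target`

The registered stub asks, for every conformal rectangle `R` and `t₁ ∈ (0,1)`, for a `δ`-UNIFORM
`ρ > 0` such that for all small meshes `δ > 0` the crossing-restricted self-dual FK polynomial
`N_δ = fkTwoArcCrossingPolynomial R δ .joint ∈ ℕ[X]` has no zero on the complex
`ρ`-neighbourhood `U_ρ` of `[t₁, 1]`; its sibling `stub_zeroFreeNonCrossing` asks the same for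
`N^c_δ = Z_δ − N_δ` (`Z_δ = fkTwoArcPartitionPolynomials R δ .joint`).  The `δ`-uniformity is a
volume-uniform Lee–Yang statement AT criticality (open in print; the per-mesh content is the
landed `…StubZeroFreeCrossing.lean`).  This file proves the part of both sibling stubs that the
ROUTE THESIS already pays for.  Under `Target = SmallFugacityLimit ∧ UniformAnalyticExtension`:

* `zeroFreeCrossing_omits_of_target` — for every `R`, `t₁ ∈ (0,1)` there is a `δ`-uniform `ρ > 0`
  such that, eventually as `δ → 0⁺`, `N_δ = h_δ · Z_δ` on `U_ρ` for a function `h_δ` HOLOMORPHIC on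
  `U_ρ` and OMITTING the two values `0` and `1` there.  Proof: `UniformAnalyticExtension` gives
  bounded holomorphic extensions `g_δ` of `t ↦ u_R(t, δ) = N_δ(t)/Z_δ(t)` near `[t₁, 1]`; by the
  identity theorem `N_δ = g_δ Z_δ` on the (convex) neighbourhood; by Vitali–Porter in its uniform
  form (`tendstoUniformlyOn_thickening_of_frequently_tendsto`) and the all-fugacity limit
  `u_R(t, δ) → U(t, η)` (`cardyUST_target_allFugacity`), `g_δ → Uc` uniformly on a compact
  neighbourhood of the segment, where `Uc` is the analytic continuation of the Miller–Werner law
  (`continuumFamily_proof`), which takes values in `(0,1)` on the segment (`mwZ_pos`), hence stays a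
  positive distance away from `{0, 1}` on a thinner compact neighbourhood; so does `g_δ` eventually.
* `zeroFreeCrossing_of_target`, `zeroFreeNonCrossing_of_target` — hence on `U_ρ`, wherever
  `Z_δ(z) ≠ 0`, also `N_δ(z) ≠ 0` and `N_δ(z) ≠ Z_δ(z)`.
* `stub_zeroFreeCrossing_of_target`, `stub_zeroFreeNonCrossing_of_target` — the two registered
  sibling stubs follow from `Target` and the registered stub `stub_zeroFreeJoint` (literal
  `δ`-uniform zero-freeness of `Z_δ`, its body taken verbatim as a hypothesis): the Schottky line
  bets on nothing beyond the route thesis plus the ONE Lee–Yang statement for `Z_δ`.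
-/

noncomputable section

open Filter Topology Set Polynomial Metric
open Literature.Probability.LatticeModels
open Literature.Probability.RandomPlanarGeometry (ConformalRectangle)

namespace Summit.CriticalPhenomena.CardyFormulaZ2.Cruxes.UniformAnalyticExtension.Birth

open Summit.CriticalPhenomena.CardyFormulaZ2.Theorems
open Summit.CriticalPhenomena.CardyFormulaZ2.Theses.CardyUSTContinuation

/-! ### Three pieces of complex analysis -/

/-- **Identity theorem on the thickened segment.** If `g` is holomorphic on the `ρ`-neighbourhood
`S` of `[t₁, 1] ⊆ ℂ` (`t₁ < 1`) and equals the quotient `N/Z` of two polynomials at the real points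
of `[t₁, 1]` (where `Z ≠ 0`), then `N = g · Z` on all of `S` (`S` is convex, hence preconnected,
and the real points accumulate inside `S`). [folklore] -/
theorem omits_aeval_eq_mul {t₁ ρ : ℝ} (ht₁ : t₁ < 1) (hρ : 0 < ρ) (N Z : ℕ[X]) {g : ℂ → ℂ}
    (hg : DifferentiableOn ℂ g (thickening ρ (((↑) : ℝ → ℂ) '' Set.Icc t₁ 1)))
    (hZ : ∀ t ∈ Set.Icc t₁ 1, aeval (t : ℂ) Z ≠ 0)
    (heq : ∀ t ∈ Set.Icc t₁ 1, g t = aeval (t : ℂ) N / aeval (t : ℂ) Z) :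
    ∀ z ∈ thickening ρ (((↑) : ℝ → ℂ) '' Set.Icc t₁ 1), aeval z N = g z * aeval z Z := by
  set S : Set ℂ := thickening ρ (((↑) : ℝ → ℂ) '' Set.Icc t₁ 1) with hS
  have hSo : IsOpen S := isOpen_thickening
  have hSc : IsPreconnected S := ((convex_ofReal_image_Icc t₁ 1).thickening ρ).isPreconnected
  set F : ℂ → ℂ := fun z => aeval z N - g z * aeval z Z with hF
  have hFd : DifferentiableOn ℂ F S :=
    (Polynomial.differentiable_aeval N).differentiableOn.sub
      (hg.mul (Polynomial.differentiable_aeval Z).differentiableOn)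
  set c : ℝ := (t₁ + 1) / 2 with hc
  have hct₁ : t₁ < c := by rw [hc]; linarith
  have hc1 : c < 1 := by rw [hc]; linarith
  have hcS : (c : ℂ) ∈ S := self_subset_thickening hρ _ ⟨c, ⟨hct₁.le, hc1.le⟩, rfl⟩
  have htend : Tendsto (fun s : ℝ => (s : ℂ)) (𝓝[≠] c) (𝓝[≠] (c : ℂ)) := by
    refine tendsto_nhdsWithin_iff.2
      ⟨Complex.continuous_ofReal.continuousAt.tendsto.mono_left nhdsWithin_le_nhds, ?_⟩
    filter_upwards [self_mem_nhdsWithin] with s hs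
    simpa using hs
  have hFr : ∀ t ∈ Set.Icc t₁ 1, F t = 0 := by
    intro t ht
    simp only [hF, heq t ht, div_mul_cancel₀ _ (hZ t ht), sub_self]
  have hfreq : ∃ᶠ z in 𝓝[≠] (c : ℂ), F z = 0 := by
    have hnear : ∀ᶠ s : ℝ in 𝓝[≠] c, s ∈ Set.Icc t₁ 1 :=
      mem_nhdsWithin_of_mem_nhds (Icc_mem_nhds hct₁ hc1)
    exact htend.frequently (hnear.mono fun s hs => hFr s hs).frequently
  have hF0 := (hFd.analyticOnNhd hSo).eqOn_zero_of_preconnected_of_frequently_eq_zero hSc hcS hfreq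
  intro z hz
  have h := hF0 hz
  simp only [hF, Pi.zero_apply] at h
  exact sub_eq_zero.1 h

/-- **A uniform margin away from `{0, 1}`.** A function continuous on an open `V ⊇ K`, `K`
compact, which omits `0` and `1` on `K`, stays at distance `≥ m > 0` from both `0` and `1` on some
compact neighbourhood `cthickening ρ K ⊆ V` of `K`. [folklore] -/
theorem omits_exists_margin {K V : Set ℂ} (hK : IsCompact K) (hV : IsOpen V) (hKV : K ⊆ V)
    {f : ℂ → ℂ} (hf : ContinuousOn f V) (h01 : ∀ z ∈ K, f z ≠ 0 ∧ f z ≠ 1) :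
    ∃ ρ > (0:ℝ), ∃ m > (0:ℝ), cthickening ρ K ⊆ V ∧
      ∀ z ∈ cthickening ρ K, m ≤ ‖f z‖ ∧ m ≤ ‖f z - 1‖ := by
  have hT : IsOpen (({0}ᶜ ∩ {1}ᶜ : Set ℂ)) := isOpen_compl_singleton.inter isOpen_compl_singleton
  have hW : IsOpen (V ∩ f ⁻¹' ({0}ᶜ ∩ {1}ᶜ)) := hf.isOpen_inter_preimage hV hT
  have hKW : K ⊆ V ∩ f ⁻¹' ({0}ᶜ ∩ {1}ᶜ) := fun z hz => ⟨hKV hz, (h01 z hz).1, (h01 z hz).2⟩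
  obtain ⟨ρ, hρ, hρW⟩ := hK.exists_cthickening_subset_open hW hKW
  have hK₂V : cthickening ρ K ⊆ V := fun z hz => (hρW hz).1
  have hK₂ : IsCompact (cthickening ρ K) := hK.cthickening
  have hI : IsCompact (f '' cthickening ρ K) := hK₂.image_of_continuousOn (hf.mono hK₂V)
  have hIT : f '' cthickening ρ K ⊆ {0}ᶜ ∩ {1}ᶜ := by
    rintro _ ⟨z, hz, rfl⟩
    exact (hρW hz).2
  obtain ⟨m, hm, hmT⟩ := hI.exists_thickening_subset_open hT hIT
  refine ⟨ρ, hρ, m, hm, hK₂V, fun z hz => ⟨?_, ?_⟩⟩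
  · refine le_of_not_gt fun h => ?_
    have h0 : (0:ℂ) ∈ thickening m (f '' cthickening ρ K) :=
      mem_thickening_iff.2 ⟨f z, ⟨z, hz, rfl⟩, by rwa [dist_comm, dist_zero_right]⟩
    exact (hmT h0).1 (Set.mem_singleton _)
  · refine le_of_not_gt fun h => ?_
    have h1 : (1:ℂ) ∈ thickening m (f '' cthickening ρ K) :=
      mem_thickening_iff.2 ⟨f z, ⟨z, hz, rfl⟩, by rwa [dist_comm, dist_eq_norm]⟩
    exact (hmT h1).2 (Set.mem_singleton _)

/-- **Core of the fallback, one conformal rectangle, abstract form.** Data: bounded holomorphic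
extensions `g_δ` of `t ↦ u t δ` near `[t₁, 1]` (eventually in `δ`), an analytic continuation `Uc`
of the limit law `V` near `[0, 1]`, pointwise limits `u t δ → V t` on `(t₁, 1)`, `V ∈ (0,1)` on
`[t₁, 1]`, and the ratio identity `u t δ = N_δ(t)/Z_δ(t)` (with `Z_δ(t) ≠ 0`) on `[t₁, 1]`.
Conclusion: on a `δ`-uniform thinner neighbourhood, eventually in `δ`, `N_δ = h · Z_δ` with `h`
holomorphic omitting `0` and `1` (identity theorem, uniform Vitali–Porter, margin of `Uc`).
[folklore] -/
theorem omits_core {t₁ : ℝ} (ht₁ : t₁ ∈ Set.Ioo (0:ℝ) 1) (V : ℝ → ℝ) (u : ℝ → ℝ → ℝ)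
    (N Z : ℝ → ℕ[X])
    (hA : ∃ ρ > (0:ℝ), ∃ M : ℝ, ∀ᶠ δ in 𝓝[>] (0:ℝ), ∃ g : ℂ → ℂ,
        DifferentiableOn ℂ g (thickening ρ (((↑) : ℝ → ℂ) '' Set.Icc t₁ 1)) ∧
        (∀ z ∈ thickening ρ (((↑) : ℝ → ℂ) '' Set.Icc t₁ 1), ‖g z‖ ≤ M) ∧
        ∀ t ∈ Set.Icc t₁ 1, g t = u t δ)
    (hC₂ : ∃ ρ > (0:ℝ), ∃ Uc : ℂ → ℂ,
      DifferentiableOn ℂ Uc (thickening ρ (((↑) : ℝ → ℂ) '' Set.Icc (0:ℝ) 1)) ∧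
        ∀ t ∈ Set.Icc (0:ℝ) 1, Uc t = V t)
    (hL : ∀ t ∈ Set.Ioo t₁ 1, Tendsto (fun δ => u t δ) (𝓝[>] 0) (𝓝 (V t)))
    (hV01 : ∀ t ∈ Set.Icc t₁ 1, V t ∈ Set.Ioo (0:ℝ) 1)
    (hu : ∀ᶠ δ in 𝓝[>] (0:ℝ), ∀ t ∈ Set.Icc t₁ 1,
        aeval (t : ℂ) (Z δ) ≠ 0 ∧ ((u t δ : ℝ) : ℂ) = aeval (t : ℂ) (N δ) / aeval (t : ℂ) (Z δ)) :
    ∃ ρ > (0:ℝ), ∀ᶠ δ in 𝓝[>] (0:ℝ),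
      ∃ h : ℂ → ℂ, DifferentiableOn ℂ h (thickening ρ (((↑) : ℝ → ℂ) '' Set.Icc t₁ 1)) ∧
        (∀ z ∈ thickening ρ (((↑) : ℝ → ℂ) '' Set.Icc t₁ 1), h z ≠ 0 ∧ h z ≠ 1) ∧
        ∀ z ∈ thickening ρ (((↑) : ℝ → ℂ) '' Set.Icc t₁ 1),
          aeval z (N δ) = h z * aeval z (Z δ) := by
  obtain ⟨ρ₀, hρ₀, M, hAev⟩ := hA
  obtain ⟨ρc, hρc, Uc, hUc, hUcU⟩ := hC₂
  set K : Set ℂ := ((↑) : ℝ → ℂ) '' Set.Icc t₁ 1 with hK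
  set ρ₁ : ℝ := min ρ₀ ρc with hρ₁
  have hρ₁0 : 0 < ρ₁ := lt_min hρ₀ hρc
  have hsub₀ : thickening ρ₁ K ⊆ thickening ρ₀ K := thickening_mono (min_le_left _ _) _
  have hsubc : thickening ρ₁ K ⊆ thickening ρc (((↑) : ℝ → ℂ) '' Set.Icc (0:ℝ) 1) :=
    (thickening_mono (min_le_right _ _) _).trans
      (thickening_subset_of_subset _ (Set.image_mono (Set.Icc_subset_Icc_left ht₁.1.le)))
  -- choose the analytic extensions `g δ` (arbitrary where none exists)
  obtain ⟨g, hgP⟩ : ∃ g : ℝ → ℂ → ℂ, ∀ᶠ δ in 𝓝[>] (0:ℝ),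
      DifferentiableOn ℂ (g δ) (thickening ρ₀ K) ∧ (∀ z ∈ thickening ρ₀ K, ‖g δ z‖ ≤ M) ∧
      ∀ s ∈ Set.Icc t₁ 1, g δ s = u s δ :=
    ⟨fun δ => Classical.epsilon (fun g : ℂ → ℂ =>
        DifferentiableOn ℂ g (thickening ρ₀ K) ∧ (∀ z ∈ thickening ρ₀ K, ‖g z‖ ≤ M) ∧
        ∀ s ∈ Set.Icc t₁ 1, g s = u s δ),
      hAev.mono fun δ hδ => Classical.epsilon_spec hδ⟩
  -- the accumulation point `c` (midpoint of the segment)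
  set c : ℝ := (t₁ + 1) / 2 with hc
  have hct₁ : t₁ < c := by rw [hc]; linarith [ht₁.2]
  have hc1 : c < 1 := by rw [hc]; linarith [ht₁.2]
  have hcK : (c : ℂ) ∈ thickening ρ₁ K :=
    self_subset_thickening hρ₁0 K ⟨c, ⟨hct₁.le, hc1.le⟩, rfl⟩
  -- pointwise convergence `g δ s → Uc s` at the real points near `c`
  have hconv : ∃ᶠ s : ℝ in 𝓝[≠] c, Tendsto (fun δ => g δ s) (𝓝[>] 0) (𝓝 (Uc s)) := by
    have hnear : ∀ᶠ s : ℝ in 𝓝[≠] c, s ∈ Set.Ioo t₁ 1 :=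
      mem_nhdsWithin_of_mem_nhds (Ioo_mem_nhds hct₁ hc1)
    refine (hnear.mono fun s hs => ?_).frequently
    have hlimC : Tendsto (fun δ => ((u s δ : ℝ) : ℂ)) (𝓝[>] 0) (𝓝 ((V s : ℝ) : ℂ)) :=
      (Complex.continuous_ofReal.tendsto _).comp (hL s hs)
    rw [hUcU s ⟨(ht₁.1.trans hs.1).le, hs.2.le⟩]
    refine hlimC.congr' ?_
    filter_upwards [hgP] with δ hδ
    exact (hδ.2.2 s ⟨hs.1.le, hs.2.le⟩).symm
  -- `Uc` omits `0` and `1` on the compact segment, hence with a margin on a compact neighbourhood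
  have hKc : IsCompact K := isCompact_Icc.image Complex.continuous_ofReal
  have hUc₁ : DifferentiableOn ℂ Uc (thickening ρ₁ K) := hUc.mono hsubc
  have hK01 : ∀ z ∈ K, Uc z ≠ 0 ∧ Uc z ≠ 1 := by
    rintro _ ⟨t, ht, rfl⟩
    have hV := hV01 t ht
    rw [hUcU t ⟨ht₁.1.le.trans ht.1, ht.2⟩]
    exact ⟨Complex.ofReal_ne_zero.2 hV.1.ne', fun h => hV.2.ne (Complex.ofReal_eq_one.1 h)⟩
  obtain ⟨ρ₂, hρ₂, m, hm, hK₂sub, hmargin⟩ :=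
    omits_exists_margin hKc isOpen_thickening (self_subset_thickening hρ₁0 K) hUc₁.continuousOn hK01
  -- Vitali–Porter, uniform form, on the compact neighbourhood `cthickening ρ₂ K`
  have hVit := tendstoUniformlyOn_thickening_of_frequently_tendsto (M := M) g Uc
    (hgP.mono fun δ hδ => ⟨hδ.1.mono hsub₀, fun z hz => hδ.2.1 z (hsub₀ hz)⟩)
    hUc₁ hcK hconv hKc.cthickening hK₂sub
  refine ⟨ρ₂, hρ₂, ?_⟩
  filter_upwards [(Metric.tendstoUniformlyOn_iff.1 hVit) m hm, hgP, hu] with δ hδm hgδ huδ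
  have hsub₂ : thickening ρ₂ K ⊆ thickening ρ₀ K :=
    ((thickening_subset_cthickening ρ₂ K).trans hK₂sub).trans hsub₀
  refine ⟨g δ, hgδ.1.mono hsub₂, fun z hz => ?_, fun z hz => ?_⟩
  · have hz₂ : z ∈ cthickening ρ₂ K := thickening_subset_cthickening ρ₂ K hz
    have hd := hδm z hz₂
    obtain ⟨hm0, hm1⟩ := hmargin z hz₂
    constructor
    · intro h0
      rw [h0, dist_zero_right] at hd
      exact lt_irrefl _ (hd.trans_le hm0)
    · intro h1
      rw [h1, dist_eq_norm] at hd
      exact lt_irrefl _ (hd.trans_le hm1)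
  · exact omits_aeval_eq_mul ht₁.2 hρ₀ (N δ) (Z δ) hgδ.1 (fun t ht => (huδ t ht).1)
      (fun t ht => by rw [hgδ.2.2 t ht]; exact (huδ t ht).2) z (hsub₂ hz)

/-! ### The lattice and continuum inputs -/

/-- **The Miller–Werner law is a non-degenerate probability on `(0, 1]`.** For `t ∈ (0, 1]` and
`η ∈ (0, 1)`, `U(t, η) = t Z(η) / (Z(1−η) + t Z(η)) ∈ (0, 1)`, since `Z(u, ·) > 0` on `(0,1)` for
the exponent `u = arccos(−t/2)/π ∈ [1/2, 2/3]` (`mwZ_pos`, `arccos_div_pi_mem_Icc`).  Stated for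
abstract `Z`, `U` bound to the route's `let`-definitions by equations. [folklore] -/
theorem omits_mwU_mem_Ioo {Z U : ℝ → ℝ → ℝ}
    (hZ : Z = fun u x => x ^ (u / 2) * (1 - x) ^ (1 - 3 * u / 2) * ₂F₁ u (1 - u) (2 * u) x)
    (hU : U = fun t η => t * Z (Real.arccos (-(t / 2)) / Real.pi) η /
      (Z (Real.arccos (-(t / 2)) / Real.pi) (1 - η) + t * Z (Real.arccos (-(t / 2)) / Real.pi) η))
    {t η : ℝ} (ht : t ∈ Set.Ioc (0:ℝ) 1) (hη : η ∈ Set.Ioo (0:ℝ) 1) :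
    U t η ∈ Set.Ioo (0:ℝ) 1 := by
  have hu := ContinuumFamilyExt.arccos_div_pi_mem_Icc ⟨ht.1.le, ht.2⟩
  have hv0 : 0 < Real.arccos (-(t / 2)) / Real.pi := by linarith [hu.1]
  have hv1 : Real.arccos (-(t / 2)) / Real.pi ≤ 1 := by linarith [hu.2]
  have h1η : 1 - η ∈ Set.Ioo (0:ℝ) 1 := ⟨by linarith [hη.2], by linarith [hη.1]⟩
  have hZ1 : 0 < Z (Real.arccos (-(t / 2)) / Real.pi) η := by
    rw [hZ]; exact ContinuumFamilyExt.mwZ_pos hv0 hv1 hη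
  have hZ2 : 0 < Z (Real.arccos (-(t / 2)) / Real.pi) (1 - η) := by
    rw [hZ]; exact ContinuumFamilyExt.mwZ_pos hv0 hv1 h1η
  have ha : 0 < t * Z (Real.arccos (-(t / 2)) / Real.pi) η := mul_pos ht.1 hZ1
  rw [hU]
  exact ⟨div_pos ha (by linarith), (div_lt_one (by linarith)).2 (by linarith)⟩

/-- **The ratio identity pushed to `ℂ`.** For `δ > 0` and real `t > 0`: `Z_δ(↑t) ≠ 0` and the
jointly-wired self-dual FK crossing probability `u_R(t, δ)` (the route's `uJ R t δ`), cast to `ℂ`,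
is `N_δ(↑t) / Z_δ(↑t)` (`measureReal_fkDomainMeasure_discreteCrossing`). [folklore] -/
theorem omits_uJ_eq_ratio (R : ConformalRectangle) {δ : ℝ} (hδ : 0 < δ) {t : ℝ} (ht : 0 < t) :
    aeval (t : ℂ) (fkTwoArcPartitionPolynomials R δ ArcWiring.joint) ≠ 0 ∧
      (((if h : 0 < δ then (@Literature.Probability.LatticeModels.fkDomainMeasure R.carrier δ
          (t / (1 + t)) (t ^ 2) (R.arc 0 ∪ R.arc 2)
          (Literature.Probability.LatticeModels.meshDomain_finite R.isBounded h).fintype).real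
          (Literature.Probability.Percolation.discreteCrossing R.carrier δ (R.arc 0) (R.arc 2))
        else 0 : ℝ)) : ℂ) =
        aeval (t : ℂ) (fkTwoArcCrossingPolynomial R δ ArcWiring.joint) /
          aeval (t : ℂ) (fkTwoArcPartitionPolynomials R δ ArcWiring.joint) := by
  have hZt : aeval (t : ℂ) (fkTwoArcPartitionPolynomials R δ ArcWiring.joint) ≠ 0 := by
    rw [← ratioToCrux_ofReal_aeval_natPoly, Complex.ofReal_ne_zero]
    exact (ratioToCrux_aeval_partition_pos R hδ ht _).ne'
  refine ⟨hZt, ?_⟩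
  simp only [dif_pos hδ]
  rw [@measureReal_fkDomainMeasure_discreteCrossing R δ hδ t ht
      ((meshDomain_finite R.isBounded hδ).fintype),
    Complex.ofReal_div, ratioToCrux_ofReal_aeval_natPoly, ratioToCrux_ofReal_aeval_natPoly]

/-! ### The fallback: under `Target` the crossing ratio omits `0` and `1` -/

open Literature.Probability.RandomPlanarGeometry in
/-- **Under `Target`, `N_δ / Z_δ` is eventually a holomorphic function omitting `0` and `1` on a
`δ`-uniform neighbourhood of `[t₁, 1]`.** For every conformal rectangle `R` and `t₁ ∈ (0,1)`
there is `ρ > 0` such that for all small `δ > 0` there is `h` holomorphic on the complex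
`ρ`-neighbourhood `U_ρ` of `[t₁, 1]` with `h ≠ 0`, `h ≠ 1` and `N_δ = h · Z_δ` on `U_ρ`.
Ingredients: `UniformAnalyticExtension` (= `Target.2`), the all-fugacity Miller–Werner limit
`cardyUST_target_allFugacity`, `continuumFamily_proof` (ii), uniform Vitali–Porter
`tendstoUniformlyOn_thickening_of_frequently_tendsto`, and uniformizing data
(`MarkedDomain.exists_isUniformizing_holds`). [folklore] -/
theorem zeroFreeCrossing_omits_of_target :
    Summit.CriticalPhenomena.CardyFormulaZ2.Theses.CardyUSTContinuation.Target →
    ∀ R : ConformalRectangle, ∀ t₁ ∈ Set.Ioo (0:ℝ) 1, ∃ ρ > (0:ℝ), ∀ᶠ δ in 𝓝[>] (0:ℝ),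
      ∃ h : ℂ → ℂ, DifferentiableOn ℂ h (thickening ρ (((↑) : ℝ → ℂ) '' Set.Icc t₁ 1)) ∧
        (∀ z ∈ thickening ρ (((↑) : ℝ → ℂ) '' Set.Icc t₁ 1), h z ≠ 0 ∧ h z ≠ 1) ∧
        ∀ z ∈ thickening ρ (((↑) : ℝ → ℂ) '' Set.Icc t₁ 1),
          aeval z (fkTwoArcCrossingPolynomial R δ ArcWiring.joint) =
            h z * aeval z (fkTwoArcPartitionPolynomials R δ ArcWiring.joint) := by
  intro hT
  -- name the route's `let`-bound functions
  obtain ⟨Z, hZ⟩ : ∃ Z : ℝ → ℝ → ℝ,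
      Z = fun u x => x ^ (u / 2) * (1 - x) ^ (1 - 3 * u / 2) * ₂F₁ u (1 - u) (2 * u) x := ⟨_, rfl⟩
  obtain ⟨U, hU⟩ : ∃ U : ℝ → ℝ → ℝ,
      U = fun t η => t * Z (Real.arccos (-(t / 2)) / Real.pi) η /
        (Z (Real.arccos (-(t / 2)) / Real.pi) (1 - η) +
          t * Z (Real.arccos (-(t / 2)) / Real.pi) η) := ⟨_, rfl⟩
  obtain ⟨uJ, huJ⟩ : ∃ uJ : ConformalRectangle → ℝ → ℝ → ℝ, uJ = fun R t δ => if h : 0 < δ then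
        (@Literature.Probability.LatticeModels.fkDomainMeasure R.carrier δ (t / (1 + t)) (t ^ 2)
          (R.arc 0 ∪ R.arc 2)
          (Literature.Probability.LatticeModels.meshDomain_finite R.isBounded h).fintype).real
          (Literature.Probability.Percolation.discreteCrossing R.carrier δ (R.arc 0) (R.arc 2))
        else 0 := ⟨_, rfl⟩
  have hA : ∀ R : ConformalRectangle, ∀ t₁ ∈ Set.Ioo (0:ℝ) 1, ∃ ρ > (0:ℝ), ∃ M : ℝ,
      ∀ᶠ δ in 𝓝[>] (0:ℝ), ∃ g : ℂ → ℂ,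
        DifferentiableOn ℂ g (Metric.thickening ρ (((↑) : ℝ → ℂ) '' Set.Icc t₁ 1)) ∧
        (∀ z ∈ Metric.thickening ρ (((↑) : ℝ → ℂ) '' Set.Icc t₁ 1), ‖g z‖ ≤ M) ∧
        ∀ t ∈ Set.Icc t₁ 1, g t = uJ R t δ := by
    subst huJ; exact hT.2
  have hC := continuumFamily_proof
  unfold ContinuumFamily at hC
  have hC₂ : ∀ η ∈ Set.Ioo (0:ℝ) 1, ∃ ρ > (0:ℝ), ∃ Uc : ℂ → ℂ,
      DifferentiableOn ℂ Uc (Metric.thickening ρ (((↑) : ℝ → ℂ) '' Set.Icc (0:ℝ) 1)) ∧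
        ∀ t ∈ Set.Icc (0:ℝ) 1, Uc t = U t η := by
    subst hU hZ; exact hC.2
  have hL : ∀ R : ConformalRectangle,
      ∀ t ∈ Set.Ioc (0:ℝ) 1, R.HasCrossingLimit (fun δ => uJ R t δ) (U t) := by
    subst hU hZ huJ; exact cardyUST_target_allFugacity hT
  intro R t₁ ht₁
  obtain ⟨φ, x, hφx⟩ := MarkedDomain.exists_isUniformizing_holds R
  have hη01 : crossRatio x ∈ Set.Ioo (0:ℝ) 1 :=
    ConformalRectangle.crossRatio_mem_Ioo_of_isUniformizing hφx
  refine omits_core ht₁ (fun t => U t (crossRatio x))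
    (uJ R) (fun δ => fkTwoArcCrossingPolynomial R δ ArcWiring.joint)
    (fun δ => fkTwoArcPartitionPolynomials R δ ArcWiring.joint) (hA R t₁ ht₁) (hC₂ _ hη01)
    (fun t ht => hL R t ⟨ht₁.1.trans ht.1, ht.2.le⟩ φ x hφx)
    (fun t ht => omits_mwU_mem_Ioo hZ hU ⟨ht₁.1.trans_le ht.1, ht.2⟩ hη01) ?_
  filter_upwards [self_mem_nhdsWithin] with δ hδ t ht
  subst huJ
  exact omits_uJ_eq_ratio R hδ (ht₁.1.trans_le ht.1)

/-- **Corollary: under `Target`, `N_δ ≠ 0` off the zeros of `Z_δ`.** For every `R`, `t₁ ∈ (0,1)`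
there is a `δ`-uniform `ρ > 0` such that for all small `δ > 0`, at every point of the
`ρ`-neighbourhood of `[t₁, 1]` where `Z_δ ≠ 0`, also `N_δ ≠ 0` (the registered stub
`stub_zeroFreeCrossing` modulo the zeros of `Z_δ`). [folklore] -/
theorem zeroFreeCrossing_of_target
    (hT : Summit.CriticalPhenomena.CardyFormulaZ2.Theses.CardyUSTContinuation.Target) :
    ∀ R : ConformalRectangle, ∀ t₁ ∈ Set.Ioo (0:ℝ) 1, ∃ ρ > (0:ℝ), ∀ᶠ δ in 𝓝[>] (0:ℝ),
      ∀ z ∈ thickening ρ (((↑) : ℝ → ℂ) '' Set.Icc t₁ 1),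
        aeval z (fkTwoArcPartitionPolynomials R δ ArcWiring.joint) ≠ 0 →
          aeval z (fkTwoArcCrossingPolynomial R δ ArcWiring.joint) ≠ 0 := by
  intro R t₁ ht₁
  obtain ⟨ρ, hρ, hev⟩ := zeroFreeCrossing_omits_of_target hT R t₁ ht₁
  refine ⟨ρ, hρ, ?_⟩
  filter_upwards [hev] with δ hδ
  obtain ⟨h, -, h01, hNZ⟩ := hδ
  intro z hz hZ
  rw [hNZ z hz]
  exact mul_ne_zero (h01 z hz).1 hZ

/-- **Corollary: under `Target`, `N_δ ≠ Z_δ` off the zeros of `Z_δ`.** For every `R`,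
`t₁ ∈ (0,1)` there is a `δ`-uniform `ρ > 0` such that for all small `δ > 0`, at every point of
the `ρ`-neighbourhood of `[t₁, 1]` where `Z_δ ≠ 0`, also `N_δ ≠ Z_δ`, i.e. the non-crossing
polynomial `N^c_δ = Z_δ − N_δ` does not vanish (the registered stub `stub_zeroFreeNonCrossing`
modulo the zeros of `Z_δ`). [folklore] -/
theorem zeroFreeNonCrossing_of_target
    (hT : Summit.CriticalPhenomena.CardyFormulaZ2.Theses.CardyUSTContinuation.Target) :
    ∀ R : ConformalRectangle, ∀ t₁ ∈ Set.Ioo (0:ℝ) 1, ∃ ρ > (0:ℝ), ∀ᶠ δ in 𝓝[>] (0:ℝ),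
      ∀ z ∈ thickening ρ (((↑) : ℝ → ℂ) '' Set.Icc t₁ 1),
        aeval z (fkTwoArcPartitionPolynomials R δ ArcWiring.joint) ≠ 0 →
          aeval z (fkTwoArcCrossingPolynomial R δ ArcWiring.joint) ≠
            aeval z (fkTwoArcPartitionPolynomials R δ ArcWiring.joint) := by
  intro R t₁ ht₁
  obtain ⟨ρ, hρ, hev⟩ := zeroFreeCrossing_omits_of_target hT R t₁ ht₁
  refine ⟨ρ, hρ, ?_⟩
  filter_upwards [hev] with δ hδ
  obtain ⟨h, -, h01, hNZ⟩ := hδ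
  intro z hz hZ hEq
  rw [hNZ z hz] at hEq
  exact (h01 z hz).2 ((mul_eq_right₀ hZ).1 hEq)

/-- **The registered stub `stub_zeroFreeCrossing` from `Target` and the registered stub
`stub_zeroFreeJoint`.** If `Target` holds and `Z_δ` is `δ`-uniformly zero-free near `[t₁, 1]`
(the body of `stub_zeroFreeJoint`, verbatim), then so is the crossing polynomial `N_δ` (the
body of `stub_zeroFreeCrossing`, verbatim). [folklore] -/
theorem stub_zeroFreeCrossing_of_target
    (hT : Summit.CriticalPhenomena.CardyFormulaZ2.Theses.CardyUSTContinuation.Target)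
    (hZ : ∀ R : ConformalRectangle, ∀ t₁ ∈ Set.Ioo (0:ℝ) 1, ∃ ρ > (0:ℝ), ∀ᶠ δ in 𝓝[>] (0:ℝ),
      ∀ z ∈ thickening ρ (((↑) : ℝ → ℂ) '' Set.Icc t₁ 1),
        aeval z (fkTwoArcPartitionPolynomials R δ ArcWiring.joint) ≠ 0) :
    ∀ R : ConformalRectangle, ∀ t₁ ∈ Set.Ioo (0:ℝ) 1, ∃ ρ > (0:ℝ), ∀ᶠ δ in 𝓝[>] (0:ℝ),
      ∀ z ∈ thickening ρ (((↑) : ℝ → ℂ) '' Set.Icc t₁ 1),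
        aeval z (fkTwoArcCrossingPolynomial R δ ArcWiring.joint) ≠ 0 := by
  intro R t₁ ht₁
  obtain ⟨ρ₁, hρ₁, h₁⟩ := hZ R t₁ ht₁
  obtain ⟨ρ₂, hρ₂, h₂⟩ := zeroFreeCrossing_of_target hT R t₁ ht₁
  refine ⟨min ρ₁ ρ₂, lt_min hρ₁ hρ₂, ?_⟩
  filter_upwards [h₁, h₂] with δ h₁δ h₂δ z hz
  exact h₂δ z (thickening_mono (min_le_right _ _) _ hz)
    (h₁δ z (thickening_mono (min_le_left _ _) _ hz))

/-- **The registered stub `stub_zeroFreeNonCrossing` from `Target` and the registered stub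
`stub_zeroFreeJoint`.** If `Target` holds and `Z_δ` is `δ`-uniformly zero-free near `[t₁, 1]`
(the body of `stub_zeroFreeJoint`, verbatim), then `N_δ ≠ Z_δ` there (the body of
`stub_zeroFreeNonCrossing`, verbatim). [folklore] -/
theorem stub_zeroFreeNonCrossing_of_target
    (hT : Summit.CriticalPhenomena.CardyFormulaZ2.Theses.CardyUSTContinuation.Target)
    (hZ : ∀ R : ConformalRectangle, ∀ t₁ ∈ Set.Ioo (0:ℝ) 1, ∃ ρ > (0:ℝ), ∀ᶠ δ in 𝓝[>] (0:ℝ),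
      ∀ z ∈ thickening ρ (((↑) : ℝ → ℂ) '' Set.Icc t₁ 1),
        aeval z (fkTwoArcPartitionPolynomials R δ ArcWiring.joint) ≠ 0) :
    ∀ R : ConformalRectangle, ∀ t₁ ∈ Set.Ioo (0:ℝ) 1, ∃ ρ > (0:ℝ), ∀ᶠ δ in 𝓝[>] (0:ℝ),
      ∀ z ∈ thickening ρ (((↑) : ℝ → ℂ) '' Set.Icc t₁ 1),
        aeval z (fkTwoArcCrossingPolynomial R δ ArcWiring.joint) ≠
          aeval z (fkTwoArcPartitionPolynomials R δ ArcWiring.joint) := by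
  intro R t₁ ht₁
  obtain ⟨ρ₁, hρ₁, h₁⟩ := hZ R t₁ ht₁
  obtain ⟨ρ₂, hρ₂, h₂⟩ := zeroFreeNonCrossing_of_target hT R t₁ ht₁
  refine ⟨min ρ₁ ρ₂, lt_min hρ₁ hρ₂, ?_⟩
  filter_upwards [h₁, h₂] with δ h₁δ h₂δ z hz
  exact h₂δ z (thickening_mono (min_le_right _ _) _ hz)
    (h₁δ z (thickening_mono (min_le_left _ _) _ hz))

end Summit.CriticalPhenomena.CardyFormulaZ2.Cruxes.UniformAnalyticExtension.Birth
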